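import Summits.ResolutionOfSingularities.ResolutionOfSingularities.Theorems.PurelyInseparableDim4ResConeTwoSlotTailSigma
import HarnessLib
import HarnessLib.Audit.Tags

/-!
# Purely inseparable four-folds — TWO-SLOT POWER-CONE TAIL, σ-ASSEMBLY WITHOUT THE ENTRY LEDGER (δ3): the slot ledger is BORN two steps after
# the letter change, so a pure-corner two-slot play of straight σ-states in regime started at a change with ONE Tschirnhaus coefficient cannot
# be infinite — every prime, every σ = (n, n) + w (cell `res-dim4-pi`, K2(p) lane, B rows, row B-LF (iii-b) «K24a-PRIME-σ»; seat res-dim4-p-7 g6)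

[OURS · counted 0 · cell `res-dim4-pi` · K2(p) lane (holder res-dim4-p-12 g5 rulings g5-18: «ASSEMBLY δ = p-7 g6»).  δ2 (`…TwoSlotTailSigma`) took the slot
ledger at time 0 as a hypothesis (`hled0`); this file REMOVES it: (L1) after a pure corner step in a slot from a STRAIGHT σ-state every child monomial
of `f`-degree `≤ d − 1` has that slot's exponent `≥ n + 1` (the «ledger exception» of res-dim4-p-1 g6's backward law, read the other way), (L2) the
other slot's half travels; so two steps after the letter change the full ledger holds and `CInfGame.Exact.no_infinite_play` (res-dim4-p-9 g3) runs on
the play shifted by two.  COMPOSITION over p-1 g6 `…TwoSlotGameStepSigma` dressed by p-9 g5 `…TwoSlotGameDressingSigma` and this seat's β/δ files.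
Seat res-dim4-p-7 g6.]  Nothing here proves any TAIL(p, d, 3), K2(7), K2(p), `NoIsolatedTrap p p` or resolution of singularities in dimension ≥ 4 /
characteristic `p` — NOT proved; a conditional assembly about OUR frame's hypothetical chains (the transport layer, res-dim4-typ-1 g5's T2′, and the
entry frame, res-dim4-p-1 g6's E1, discharge its hypotheses on a real tail).  AI kernel work, weaker than expert review.
* §1 **`ledger_half_born_sigma`** (L1) · **`ledger_half_step_sigma`** (L2).
* §2 `core_step_sigma` / `core_play_sigma` — δ2's package WITHOUT the ledger (boundary, `x^r ∣ F`, `x_f^d`-coefficient, straightness, Tschirnhaus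
  powers of the current letter) at every time; `ledger_play_sigma` — the full slot ledger at every time `t ≥ 2`.
* §3 **`no_twoSlot_pureCorner_play_of_change_sigma`** — δ2's theorem minus `hled0`: guarded pure play, `ord = p + n`, `e_G = 3`, isolated at every
  time; at time 0: σ-boundary, `x^r ∣ F`, straight, ONE Tschirnhaus coefficient in the first chart letter, and a letter change `x 0 ≠ x 1` ⊢ `False`.
[cite: CossartJannsenSaito2020, Thm. 3.14, Lemma 13.2] [cite: Hauser2010, §§F–G]
bears_on: LADDER-RESOLUTION:D157-DOOR2 (res-dim4-pi · K2(p) · power cones · K24a-PRIME-σ assembly δ3).  Supports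
stmt-ResolutionOfSingularities-16155 (helper).
-/

set_option linter.dupNamespace false -- mandated namespace of this single-conjunct summit

noncomputable section

namespace Summit.ResolutionOfSingularities.ResolutionOfSingularities.Theorems.PIDim4

namespace ResCone

open MvPolynomial Finset
open Literature.AlgebraicGeometry.Resolution
open Literature.AlgebraicGeometry.Resolution.CentreBlowup
open Literature.AlgebraicGeometry.Resolution.Hauser2010
open Literature.AlgebraicGeometry.Resolution.HauserPerlega2019

variable {K : Type} [Field K] [DecidableEq K]

section Letters

variable {j i u f : Fin 4} (hji : j ≠ i) (hju : j ≠ u) (hjf : j ≠ f) (hiu : i ≠ u) (hif : i ≠ f) (huf : u ≠ f)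
include hji hju hjf hiu hif huf

/-! ## 1. The slot ledger is born at a slot step from a straight state, and travels -/

omit hiu in
/-- **(L1) THE CHART SLOT'S HALF OF THE LEDGER IS BORN**: pure corner step in the slot `j` from a σ-state (`r = n·j + n·i + w·u`, `n + w + d = p`,
`x^r ∣ F`, `ord₀ F = p + n`, `1 ≤ d`) that is STRAIGHT (no residual degree-`d` monomial except `x_f^d`): every child monomial of `f`-degree `≤ d − 1` has
`j`-exponent `≥ n + 1`. [OURS] [cite: CossartJannsenSaito2020, Lemma 13.2] -/
theorem ledger_half_born_sigma (p : ℕ) {n w d : ℕ} (hσ : n + w + d = p) (hd1 : 1 ≤ d) {s : State K}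
    (hr : s.r = Finsupp.single j n + Finsupp.single i n + Finsupp.single u w) (hdiv : ∀ e ∈ s.F.support, s.r ≤ e)
    (ho : ordZero s.F = ((p + n : ℕ) : ℕ∞))
    (hstraight : ∀ m : Fin 4 →₀ ℕ, m.degree = d → m ≠ Finsupp.single f d → coeff (s.r + m) s.F = 0) :
    ∀ e' ∈ (CentreBlowup.step p Finset.univ j 0 s).F.support, e' f ≤ d - 1 → n + 1 ≤ e' j := by
  intro e' he' hef
  obtain ⟨e, he, rfl⟩ := exists_of_mem_support_step_zero j s he'
  obtain ⟨m, rfl⟩ : ∃ m, e = s.r + m := ⟨e - s.r, (add_tsub_cancel_of_le (hdiv e he)).symm⟩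
  have hrj : s.r j = n := by rw [hr]; simp [hji, hju]
  have hrf : s.r f = 0 := by rw [hr]; simp [hjf.symm, hif.symm, huf.symm]
  have hrdeg : s.r.degree = 2 * n + w := by
    rw [hr, map_add, map_add, Finsupp.degree_single, Finsupp.degree_single, Finsupp.degree_single]; ring
  have hge : p + n ≤ (s.r + m).degree := le_degree_of_mem_support_of_ordZero ho he
  have hdeg : (s.r + m).degree = 2 * n + w + m.degree := by rw [map_add, hrdeg]
  rw [chartExponent_apply_of_ne p Finset.univ hjf.symm, Finsupp.add_apply, hrf, zero_add] at hef
  rw [chartExponent_univ_apply_self]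
  by_contra hlt
  have hmd : m.degree = d := by omega
  have hne : m ≠ Finsupp.single f d := by
    intro hm; rw [hm, Finsupp.single_eq_same] at hef; omega
  exact (MvPolynomial.mem_support_iff.mp he) (hstraight m hmd hne)

omit hju hiu hif huf in
/-- **(L2) THE OTHER SLOT'S HALF TRAVELS**: a pure corner step in `j` keeps «`f`-degree `≤ d − 1` ⇒ `i`-exponent `≥ n + 1`» (the `i`- and
`f`-exponents of a monomial are unchanged by the `j`-chart map; no births). [OURS] -/
theorem ledger_half_step_sigma (p : ℕ) {n d : ℕ} {s : State K}
    (hled : ∀ e ∈ s.F.support, e f ≤ d - 1 → n + 1 ≤ e i) :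
    ∀ e' ∈ (CentreBlowup.step p Finset.univ j 0 s).F.support, e' f ≤ d - 1 → n + 1 ≤ e' i := by
  intro e' he' hef
  obtain ⟨e, he, rfl⟩ := exists_of_mem_support_step_zero j s he'
  rw [chartExponent_apply_of_ne p Finset.univ hjf.symm] at hef
  rw [chartExponent_apply_of_ne p Finset.univ hji.symm]
  exact hled e he hef

/-! ## 2. δ2's package without the ledger; the ledger from time `2` on -/

/-- **One step of the ledger-free package (chart `j`)** (δ2's `inv_step_sigma` minus the ledger). [OURS · composition] -/
theorem core_step_sigma (p : ℕ) [Fact p.Prime] [CharP K p] {n w d : ℕ} (hσ : n + w + d = p) (hn : 1 ≤ n) (hd2 : 2 ≤ d) {s : State K}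
    (hr : s.r = Finsupp.single j n + Finsupp.single i n + Finsupp.single u w) (hdiv : ∀ e ∈ s.F.support, s.r ≤ e)
    (ho : ordZero s.F = ((p + n : ℕ) : ℕ∞)) (ha : coeff (s.r + Finsupp.single f d) s.F ≠ 0)
    (hstraight : ∀ m : Fin 4 →₀ ℕ, m.degree = d → m ≠ Finsupp.single f d → coeff (s.r + m) s.F = 0)
    (htsch : coeff (s.r + (Finsupp.single f (d - 1) + Finsupp.single j 2)) s.F = 0)
    (ho' : ordZero (CentreBlowup.step p Finset.univ j 0 s).F = ((p + n : ℕ) : ℕ∞))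
    (he3' : Module.finrank K (resVertex (CentreBlowup.step p Finset.univ j 0 s)) = 3) :
    (CentreBlowup.step p Finset.univ j 0 s).r = Finsupp.single j n + Finsupp.single i n + Finsupp.single u w ∧
      (∀ e ∈ (CentreBlowup.step p Finset.univ j 0 s).F.support, (CentreBlowup.step p Finset.univ j 0 s).r ≤ e) ∧
      coeff ((CentreBlowup.step p Finset.univ j 0 s).r + Finsupp.single f d) (CentreBlowup.step p Finset.univ j 0 s).F ≠ 0 ∧
      (∀ m : Fin 4 →₀ ℕ, m.degree = d → m ≠ Finsupp.single f d →
        coeff ((CentreBlowup.step p Finset.univ j 0 s).r + m) (CentreBlowup.step p Finset.univ j 0 s).F = 0) ∧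
      (∀ m, 2 ≤ m → coeff ((CentreBlowup.step p Finset.univ j 0 s).r + (Finsupp.single f (d - 1) + Finsupp.single i m))
        (CentreBlowup.step p Finset.univ j 0 s).F = 0) ∧
      (∀ m, 1 ≤ m → coeff ((CentreBlowup.step p Finset.univ j 0 s).r + (Finsupp.single f (d - 1) + Finsupp.single j m))
        (CentreBlowup.step p Finset.univ j 0 s).F = coeff (s.r + (Finsupp.single f (d - 1) + Finsupp.single j (m + 1))) s.F) := by
  set s' := CentreBlowup.step p Finset.univ j 0 s with hs'
  have hrj : s.r j = n := by rw [hr]; simp [hji, hju]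
  have hr' : s'.r = s.r := step_zero_r_sigma p ho hrj
  have hdiv' : ∀ e ∈ s'.F.support, s'.r ≤ e := newMult_le_of_mem_support_step p Finset.univ j 0 rfl s ho hdiv (perm_univ ho hdiv)
  have hq : ((p : ℕ) : ℕ∞) ≤ ordAlong Finset.univ s.F := by
    rw [ordAlong_univ, ho]; exact_mod_cast (by omega : p ≤ p + n)
  obtain ⟨hst', ha', -⟩ := twoSlot_legal_readings_of_corner_sigma p hσ hn hd2 hji hju hjf hiu hif huf hr hdiv ho ha hstraight htsch ho' he3'
  refine ⟨by rw [hr', hr], hdiv', by rw [hr', ha']; exact ha, fun m hm hne => by rw [hr']; exact hst' m hm hne, ?_, ?_⟩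
  · intro m hm
    have h := coeff_tschRow_step_zero_eq_zero_sigma hji hju hjf hiu hif huf p hσ hr hdiv hq (a := m) (b := 0) (by omega)
    rw [Finsupp.single_zero, add_zero] at h
    rw [hr']; exact h
  · intro m hm
    rw [hr']; exact coeff_tschRow_pure_step_zero_sigma hji hju hjf hif huf p hσ hn hd2 hr hq hm

/-- **THE LEDGER-FREE PACKAGE AT EVERY TIME** (δ2's `inv_play_sigma` minus its ledger clause, plus the purity of every step). [OURS · composition] -/
theorem core_play_sigma (p : ℕ) [Fact p.Prime] [CharP K p] {n w d : ℕ} (hσ : n + w + d = p) (hn : 1 ≤ n) (hd2 : 2 ≤ d)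
    (s : ℕ → State K) (x : ℕ → Bool)
    (hstep : ∀ t, (∃ a : K, a ≠ 0 ∧ resForm (s t) = C a * X f ^ d) →
      s (t + 1) = CentreBlowup.step p Finset.univ (if x t then j else i) 0 (s t))
    (hr0 : (s 0).r = Finsupp.single j n + Finsupp.single i n + Finsupp.single u w) (hdiv0 : ∀ e ∈ (s 0).F.support, (s 0).r ≤ e)
    (ho : ∀ t, ordZero (s t).F = ((p + n : ℕ) : ℕ∞)) (he3 : ∀ t, Module.finrank K (resVertex (s t)) = 3)
    (ha0 : coeff ((s 0).r + Finsupp.single f d) (s 0).F ≠ 0)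
    (hstraight0 : ∀ m : Fin 4 →₀ ℕ, m.degree = d → m ≠ Finsupp.single f d → coeff ((s 0).r + m) (s 0).F = 0)
    (htsch0 : coeff ((s 0).r + (Finsupp.single f (d - 1) + Finsupp.single (if x 0 then j else i) 2)) (s 0).F = 0)
    (hx01 : x 0 ≠ x 1) (t : ℕ) :
    (s t).r = Finsupp.single j n + Finsupp.single i n + Finsupp.single u w ∧ (∀ e ∈ (s t).F.support, (s t).r ≤ e) ∧
      coeff ((s t).r + Finsupp.single f d) (s t).F ≠ 0 ∧
      (∀ m : Fin 4 →₀ ℕ, m.degree = d → m ≠ Finsupp.single f d → coeff ((s t).r + m) (s t).F = 0) ∧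
      (∀ m, 2 ≤ m → (1 ≤ t ∨ m = 2) →
        coeff ((s t).r + (Finsupp.single f (d - 1) + Finsupp.single (if x t then j else i) m)) (s t).F = 0) ∧
      s (t + 1) = CentreBlowup.step p Finset.univ (if x t then j else i) 0 (s t) := by
  induction t with
  | zero =>
    have hrdeg : (s 0).r.degree = 2 * n + w := by
      rw [hr0, map_add, map_add, Finsupp.degree_single, Finsupp.degree_single, Finsupp.degree_single]; ring
    refine ⟨hr0, hdiv0, ha0, hstraight0, fun m hm h01 => ?_,
      hstep 0 ⟨_, ha0, resForm_eq_C_mul_X_pow_of_readings_sigma (ho 0) (by rw [hrdeg]; omega) rfl hstraight0⟩⟩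
    rcases h01 with h | rfl
    · omega
    · exact htsch0
  | succ t ih =>
    obtain ⟨hr, hdiv, ha, hst, hT, hs⟩ := ih
    have htsch : coeff ((s t).r + (Finsupp.single f (d - 1) + Finsupp.single (if x t then j else i) 2)) (s t).F = 0 :=
      hT 2 le_rfl (by by_cases h : 1 ≤ t <;> [exact Or.inl h; exact Or.inr rfl])
    have ho' := ho (t + 1)
    have he3' := he3 (t + 1)
    have hguard' : ∀ {S : State K}, S.r = Finsupp.single j n + Finsupp.single i n + Finsupp.single u w →
        ordZero S.F = ((p + n : ℕ) : ℕ∞) → coeff (S.r + Finsupp.single f d) S.F ≠ 0 →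
        (∀ m : Fin 4 →₀ ℕ, m.degree = d → m ≠ Finsupp.single f d → coeff (S.r + m) S.F = 0) →
        ∃ a : K, a ≠ 0 ∧ resForm S = C a * X f ^ d := by
      intro S hrS hoS haS hstS
      have hrdeg : S.r.degree = 2 * n + w := by
        rw [hrS, map_add, map_add, Finsupp.degree_single, Finsupp.degree_single, Finsupp.degree_single]; ring
      exact ⟨_, haS, resForm_eq_C_mul_X_pow_of_readings_sigma hoS (by rw [hrdeg]; omega) rfl hstS⟩
    cases hxt : x t
    · -- step in the slot `i`
      have hs1 : s (t + 1) = CentreBlowup.step p Finset.univ i 0 (s t) := by simpa [hxt] using hs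
      rw [hs1] at ho' he3' ⊢
      rw [hxt] at htsch
      simp only [Bool.false_eq_true, ↓reduceIte] at htsch
      have hr' : (s t).r = Finsupp.single i n + Finsupp.single j n + Finsupp.single u w := by rw [hr, add_comm (Finsupp.single j n)]
      obtain ⟨h1, h2, h3, h4, h6, h7⟩ := core_step_sigma hji.symm hiu hif hju hjf huf p hσ hn hd2 hr' hdiv (ho t) ha hst htsch ho' he3'
      have h1' : (CentreBlowup.step p Finset.univ i 0 (s t)).r = Finsupp.single j n + Finsupp.single i n + Finsupp.single u w := by
        rw [h1, add_comm (Finsupp.single i n)]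
      refine ⟨h1', h2, h3, h4, fun m hm _ => ?_, ?_⟩
      · cases hxt1 : x (t + 1)
        · simp only [Bool.false_eq_true, ↓reduceIte]
          rw [h7 m (by omega)]
          have h1t : 1 ≤ t := by
            by_contra h0
            have ht0 : t = 0 := by omega
            subst ht0; exact hx01 (by rw [hxt, hxt1])
          have := hT (m + 1) (by omega) (Or.inl h1t)
          simpa [hxt] using this
        · simp only [↓reduceIte]
          exact h6 m hm
      · have h := hstep (t + 1) (by rw [hs1]; exact hguard' h1' ho' h3 h4)
        rw [hs1] at h
        exact h
    · -- step in the slot `j`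
      have hs1 : s (t + 1) = CentreBlowup.step p Finset.univ j 0 (s t) := by simpa [hxt] using hs
      rw [hs1] at ho' he3' ⊢
      rw [hxt] at htsch
      simp only [↓reduceIte] at htsch
      obtain ⟨h1, h2, h3, h4, h6, h7⟩ := core_step_sigma hji hju hjf hiu hif huf p hσ hn hd2 hr hdiv (ho t) ha hst htsch ho' he3'
      refine ⟨h1, h2, h3, h4, fun m hm _ => ?_, ?_⟩
      · cases hxt1 : x (t + 1)
        · simp only [Bool.false_eq_true, ↓reduceIte]
          exact h6 m hm
        · simp only [↓reduceIte]
          rw [h7 m (by omega)]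
          have h1t : 1 ≤ t := by
            by_contra h0
            have ht0 : t = 0 := by omega
            subst ht0; exact hx01 (by rw [hxt, hxt1])
          have := hT (m + 1) (by omega) (Or.inl h1t)
          simpa [hxt] using this
      · have h := hstep (t + 1) (by rw [hs1]; exact hguard' h1 ho' h3 h4)
        rw [hs1] at h
        exact h

/-- **THE FULL SLOT LEDGER FROM TIME `2` ON**: born at times `1` and `2` (the letters differ), then re-born / carried ((L1), (L2)). [OURS] -/
theorem ledger_play_sigma (p : ℕ) [Fact p.Prime] [CharP K p] {n w d : ℕ} (hσ : n + w + d = p) (hn : 1 ≤ n) (hd2 : 2 ≤ d)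
    (s : ℕ → State K) (x : ℕ → Bool)
    (hstep : ∀ t, (∃ a : K, a ≠ 0 ∧ resForm (s t) = C a * X f ^ d) →
      s (t + 1) = CentreBlowup.step p Finset.univ (if x t then j else i) 0 (s t))
    (hr0 : (s 0).r = Finsupp.single j n + Finsupp.single i n + Finsupp.single u w) (hdiv0 : ∀ e ∈ (s 0).F.support, (s 0).r ≤ e)
    (ho : ∀ t, ordZero (s t).F = ((p + n : ℕ) : ℕ∞)) (he3 : ∀ t, Module.finrank K (resVertex (s t)) = 3)
    (ha0 : coeff ((s 0).r + Finsupp.single f d) (s 0).F ≠ 0)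
    (hstraight0 : ∀ m : Fin 4 →₀ ℕ, m.degree = d → m ≠ Finsupp.single f d → coeff ((s 0).r + m) (s 0).F = 0)
    (htsch0 : coeff ((s 0).r + (Finsupp.single f (d - 1) + Finsupp.single (if x 0 then j else i) 2)) (s 0).F = 0)
    (hx01 : x 0 ≠ x 1) (t : ℕ) (ht : 2 ≤ t) :
    ∀ e ∈ (s t).F.support, e f ≤ d - 1 → n + 1 ≤ e j ∧ n + 1 ≤ e i := by
  have core := core_play_sigma hji hju hjf hiu hif huf p hσ hn hd2 s x hstep hr0 hdiv0 ho he3 ha0 hstraight0 htsch0 hx01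
  have born : ∀ t, ∀ e ∈ (s (t + 1)).F.support, e f ≤ d - 1 → n + 1 ≤ e (if x t then j else i) := by
    intro t
    obtain ⟨hr, hdiv, -, hst, -, hs⟩ := core t
    cases hxt : x t
    · have hs1 : s (t + 1) = CentreBlowup.step p Finset.univ i 0 (s t) := by simpa [hxt] using hs
      rw [hs1]; simp only [Bool.false_eq_true, ↓reduceIte]
      have hr' : (s t).r = Finsupp.single i n + Finsupp.single j n + Finsupp.single u w := by rw [hr, add_comm (Finsupp.single j n)]
      exact ledger_half_born_sigma hji.symm hiu hif hjf huf p hσ (by omega) hr' hdiv (ho t) hst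
    · have hs1 : s (t + 1) = CentreBlowup.step p Finset.univ j 0 (s t) := by simpa [hxt] using hs
      rw [hs1]; simp only [↓reduceIte]
      exact ledger_half_born_sigma hji hju hjf hif huf p hσ (by omega) hr hdiv (ho t) hst
  have travelJ : ∀ t, (∀ e ∈ (s t).F.support, e f ≤ d - 1 → n + 1 ≤ e j) →
      ∀ e ∈ (s (t + 1)).F.support, e f ≤ d - 1 → n + 1 ≤ e j := by
    intro t h
    obtain ⟨hr, hdiv, -, hst, -, hs⟩ := core t
    cases hxt : x t
    · have hs1 : s (t + 1) = CentreBlowup.step p Finset.univ i 0 (s t) := by simpa [hxt] using hs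
      rw [hs1]; exact ledger_half_step_sigma hji.symm hif p h
    · have hs1 : s (t + 1) = CentreBlowup.step p Finset.univ j 0 (s t) := by simpa [hxt] using hs
      rw [hs1]; exact ledger_half_born_sigma hji hju hjf hif huf p hσ (by omega) hr hdiv (ho t) hst
  have travelI : ∀ t, (∀ e ∈ (s t).F.support, e f ≤ d - 1 → n + 1 ≤ e i) →
      ∀ e ∈ (s (t + 1)).F.support, e f ≤ d - 1 → n + 1 ≤ e i := by
    intro t h
    obtain ⟨hr, hdiv, -, hst, -, hs⟩ := core t
    cases hxt : x t
    · have hs1 : s (t + 1) = CentreBlowup.step p Finset.univ i 0 (s t) := by simpa [hxt] using hs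
      have hr' : (s t).r = Finsupp.single i n + Finsupp.single j n + Finsupp.single u w := by rw [hr, add_comm (Finsupp.single j n)]
      rw [hs1]; exact ledger_half_born_sigma hji.symm hiu hif hjf huf p hσ (by omega) hr' hdiv (ho t) hst
    · have hs1 : s (t + 1) = CentreBlowup.step p Finset.univ j 0 (s t) := by simpa [hxt] using hs
      rw [hs1]; exact ledger_half_step_sigma hji hjf p h
  have hJ2 : ∀ e ∈ (s 2).F.support, e f ≤ d - 1 → n + 1 ≤ e j := by
    cases hx0 : x 0
    · have hx1 : x 1 = true := by
        cases h : x 1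
        · exact absurd (hx0.trans h.symm) hx01
        · rfl
      have := born 1; rw [hx1] at this; simpa using this
    · have := born 0; rw [hx0] at this
      exact travelJ 1 (by simpa using this)
  have hI2 : ∀ e ∈ (s 2).F.support, e f ≤ d - 1 → n + 1 ≤ e i := by
    cases hx0 : x 0
    · have := born 0; rw [hx0] at this
      exact travelI 1 (by simpa using this)
    · have hx1 : x 1 = false := by
        cases h : x 1
        · rfl
        · exact absurd (hx0.trans h.symm) hx01
      have := born 1; rw [hx1] at this; simpa using this
  induction t, ht using Nat.le_induction with
  | base => exact fun e he hef => ⟨hJ2 e he hef, hI2 e he hef⟩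
  | succ t _ ih =>
    exact fun e he hef => ⟨travelJ t (fun e he hef => (ih e he hef).1) e he hef, travelI t (fun e he hef => (ih e he hef).2) e he hef⟩

end Letters

/-! ## 3. The assembly without the entry ledger -/

section Main

variable {j i u f : Fin 4} (hji : j ≠ i) (hju : j ≠ u) (hjf : j ≠ f) (hiu : i ≠ u) (hif : i ≠ f) (huf : u ≠ f)
include hji hju hjf hiu hif huf

/-- **NO INFINITE PURE-CORNER TWO-SLOT PLAY OF STRAIGHT σ-STATES IN REGIME STARTED AT A LETTER CHANGE, every prime, every σ = (n, n) + w — with NO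
ledger hypothesis** (δ3): `CInfGame.Exact.no_infinite_play` on the play shifted by two, where the slot ledger holds (`ledger_play_sigma`); the seven
binders as in δ2 (p-1's laws in p-9's dressing, this seat's β-readings).  The transport / entry layers turn a real class-(i) two-slot power-cone tail
into such a play; NOT proved here. [OURS · composition] [cite: CossartJannsenSaito2020, Thm. 3.14] -/
theorem no_twoSlot_pureCorner_play_of_change_sigma (p : ℕ) [Fact p.Prime] [CharP K p] {n w d : ℕ} (hσ : n + w + d = p) (hn : 1 ≤ n)
    (hd2 : 2 ≤ d) (s : ℕ → State K) (x : ℕ → Bool)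
    (hstep : ∀ t, (∃ a : K, a ≠ 0 ∧ resForm (s t) = C a * X f ^ d) →
      s (t + 1) = CentreBlowup.step p Finset.univ (if x t then j else i) 0 (s t))
    (hr0 : (s 0).r = Finsupp.single j n + Finsupp.single i n + Finsupp.single u w) (hdiv0 : ∀ e ∈ (s 0).F.support, (s 0).r ≤ e)
    (ho : ∀ t, ordZero (s t).F = ((p + n : ℕ) : ℕ∞)) (he3 : ∀ t, Module.finrank K (resVertex (s t)) = 3)
    (hiso : ∀ t, IsIsolated p (s t).F)
    (ha0 : coeff ((s 0).r + Finsupp.single f d) (s 0).F ≠ 0)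
    (hstraight0 : ∀ m : Fin 4 →₀ ℕ, m.degree = d → m ≠ Finsupp.single f d → coeff ((s 0).r + m) (s 0).F = 0)
    (htsch0 : coeff ((s 0).r + (Finsupp.single f (d - 1) + Finsupp.single (if x 0 then j else i) 2)) (s 0).F = 0)
    (hx01 : x 0 ≠ x 1) : False := by
  have core := core_play_sigma hji hju hjf hiu hif huf p hσ hn hd2 s x hstep hr0 hdiv0 ho he3 ha0 hstraight0 htsch0 hx01
  have led := ledger_play_sigma hji hju hjf hiu hif huf p hσ hn hd2 s x hstep hr0 hdiv0 ho he3 ha0 hstraight0 htsch0 hx01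
  -- the shifted play `t ↦ s (t + 2)`
  have hq : ∀ t, ((p : ℕ) : ℕ∞) ≤ ordAlong Finset.univ (s t).F := fun t => by
    rw [ordAlong_univ, ho t]; exact_mod_cast (by omega : p ≤ p + n)
  have h6 : ∀ t, ∀ e ∈ (s t).F.support, p + n ≤ e.degree := fun t e he => le_degree_of_mem_support_of_ordZero (ho t) he
  have hrdeg : (Finsupp.single j n + Finsupp.single i n + Finsupp.single u w : Fin 4 →₀ ℕ).degree = 2 * n + w := by
    rw [map_add, map_add, Finsupp.degree_single, Finsupp.degree_single, Finsupp.degree_single]; ring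
  have hstr : ∀ t, ∀ e ∈ (s t).F.support, e.degree = p + n → e f = d := by
    intro t e he hdeg
    obtain ⟨hr, hdiv, -, hst, -, -⟩ := core t
    obtain ⟨m, rfl⟩ : ∃ m, e = (s t).r + m := ⟨e - (s t).r, (add_tsub_cancel_of_le (hdiv e he)).symm⟩
    rw [map_add, hr, hrdeg] at hdeg
    have hmd : m.degree = d := by omega
    by_cases hm : m = Finsupp.single f d
    · rw [hm, Finsupp.add_apply, Finsupp.single_eq_same, hr]; simp [hjf.symm, hif.symm, huf.symm]
    · exact absurd (hst m hmd hm) (MvPolynomial.mem_support_iff.mp he)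
  have hrn : ∀ t, ∀ e ∈ (s t).F.support, n ≤ e j := fun t e he => by
    obtain ⟨hr, hdiv, -⟩ := core t
    have h := hdiv e he j
    rw [hr] at h; simpa [hji, hju] using h
  have hrni : ∀ t, ∀ e ∈ (s t).F.support, n ≤ e i := fun t e he => by
    obtain ⟨hr, hdiv, -⟩ := core t
    have h := hdiv e he i
    rw [hr] at h; simpa [hji.symm, hiu] using h
  refine CInfGame.Exact.no_infinite_play (fun t => x (t + 2))
    (fun t q => q.1 + 1 ≤ d ∧ coeff (Finsupp.single j (q.2.1 + n + 1) + Finsupp.single i (q.2.2.1 + n + 1) +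
      Finsupp.single u (q.2.2.2 + w) + Finsupp.single f (d - 1 - q.1)) (s (t + 2)).F ≠ 0) (d - 1)
    (fun t c a b e h => by have := h.1; omega) ?_ ?_ ?_ ?_ ?_ ?_ ?_
  · -- hfwdL
    intro t c a b e hP hxt hlive
    obtain ⟨-, -, -, -, -, hs⟩ := core (t + 2)
    have hs1 : s (t + 2 + 1) = CentreBlowup.step p Finset.univ j 0 (s (t + 2)) := by simpa [hxt] using hs
    rw [show t + 1 + 2 = t + 2 + 1 by ring, hs1]
    exact game_fwd_slot_j hji hju hjf hiu hif huf p hσ (s (t + 2)) (hq _) (h6 _) (hstr _) hP hlive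
  · -- hfwdM
    intro t c a b e hP hxt hlive
    obtain ⟨-, -, -, -, -, hs⟩ := core (t + 2)
    have hs1 : s (t + 2 + 1) = CentreBlowup.step p Finset.univ i 0 (s (t + 2)) := by simpa [hxt] using hs
    rw [show t + 1 + 2 = t + 2 + 1 by ring, hs1]
    exact game_fwd_slot_i hji hju hjf hiu hif huf p hσ (s (t + 2)) (hq _) (h6 _) (hstr _) hP hlive
  · -- hlegL
    intro t c a b e hP hxt
    obtain ⟨hr, hdiv, ha, hst, hT, hs⟩ := core (t + 2)
    have htsch := hT 2 le_rfl (Or.inl (by omega))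
    have ho' := ho (t + 2 + 1)
    have he3' := he3 (t + 2 + 1)
    have hs1 : s (t + 2 + 1) = CentreBlowup.step p Finset.univ j 0 (s (t + 2)) := by simpa [hxt] using hs
    rw [hs1] at ho' he3'
    rw [hxt] at htsch
    simp only [↓reduceIte] at htsch
    exact twoSlot_legal_gameExp_sigma hji hju hjf hiu hif huf p hσ hn hd2 hr hdiv (ho _) ha hst htsch ho' he3' hP.1 hP.2
  · -- hlegM
    intro t c a b e hP hxt
    obtain ⟨hr, hdiv, ha, hst, hT, hs⟩ := core (t + 2)
    have htsch := hT 2 le_rfl (Or.inl (by omega))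
    have ho' := ho (t + 2 + 1)
    have he3' := he3 (t + 2 + 1)
    have hs1 : s (t + 2 + 1) = CentreBlowup.step p Finset.univ i 0 (s (t + 2)) := by simpa [hxt] using hs
    rw [hs1] at ho' he3'
    rw [hxt] at htsch
    simp only [Bool.false_eq_true, ↓reduceIte] at htsch
    exact twoSlot_legalM_gameExp_sigma hji hju hjf hiu hif huf p hσ hn hd2 hr hdiv (ho _) ha hst htsch ho' he3' hP.1 hP.2
  · -- hevol
    intro t c a b e hP
    obtain ⟨hr, hdiv, ha, hst, -, hs⟩ := core (t + 2)
    have hled := led (t + 2) (by omega)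
    rw [show t + 1 + 2 = t + 2 + 1 by ring] at hP
    cases hxt : x (t + 2)
    · have hs1 : s (t + 2 + 1) = CentreBlowup.step p Finset.univ i 0 (s (t + 2)) := by simpa [hxt] using hs
      rw [hs1] at hP
      rcases game_evol_slot_i hji hju hjf hiu hif huf p hσ (s (t + 2)) (hrni _) (fun e he hef => (hled e he hef).2) hP with
        hdead | ⟨a₀, b₀, hP₀, ha', hb'⟩
      · exact Or.inl hdead
      · exact Or.inr ⟨a₀, b₀, hP₀, Or.inr ⟨rfl, ha', hb'⟩⟩
    · have hs1 : s (t + 2 + 1) = CentreBlowup.step p Finset.univ j 0 (s (t + 2)) := by simpa [hxt] using hs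
      rw [hs1] at hP
      rcases game_evol_slot_j hji hju hjf hiu hif huf p hσ (s (t + 2)) (hrn _) (fun e he hef => (hled e he hef).1) hP with
        hdead | ⟨a₀, b₀, hP₀, ha', hb'⟩
      · exact Or.inl hdead
      · exact Or.inr ⟨a₀, b₀, hP₀, Or.inl ⟨rfl, ha', hb'⟩⟩
  · -- hflagL
    intro t
    obtain ⟨hr, hdiv, -, -, -, -⟩ := core (t + 2)
    obtain ⟨c, a, b, e, hc, h, hf⟩ := twoSlot_flagL_gameExp_sigma hji hju hjf hiu hif huf p hσ hr (hiso _) hdiv (led (t + 2) (by omega))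
    exact ⟨c, a, b, e, ⟨hc, h⟩, hf⟩
  · -- hflagM
    intro t
    obtain ⟨hr, hdiv, -, -, -, -⟩ := core (t + 2)
    obtain ⟨c, a, b, e, hc, h, hf⟩ := twoSlot_flagM_gameExp_sigma hji hju hjf hiu hif huf p hσ hr (hiso _) hdiv (led (t + 2) (by omega))
    exact ⟨c, a, b, e, ⟨hc, h⟩, hf⟩

end Main

end ResCone

end Summit.ResolutionOfSingularities.ResolutionOfSingularities.Theorems.PIDim4

end
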